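import Summits.HodgeConjecture.HodgeConjecture.Theses.BiquadraticSecantLift
import Summits.HodgeConjecture.HodgeConjecture.Theorems.BiquadraticSecantLiftBiquadraticBaseChangePolarized
import HarnessLib

/-!
# BiquadraticSecantLift · X2pol `BiquadraticBaseChangePolarized` — by-name closing wrapper

Support item stmt-HodgeConjecture-26256 of route-HodgeConjecture-BiquadraticSecantLift is the route declaration
`Summit.HodgeConjecture.HodgeConjecture.Theses.BiquadraticSecantLift.BiquadraticBaseChangePolarized` (X2pol: for every
`d > 0` and every abelian sixfold `(A, φ)` with `φ ≫ φ = -d` carrying a non-zero `(3,3)` class in its Weil plane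
`weilClassesOf A φ 3 d`, some non-square `m > 0` makes `(A ⊞ A, (φ ⊞ φ) ≫ (𝟙 + ψ_m))` a POLARIZED hyperbolic
Weil-type CM datum for `X² + 2d(1+m)·X + d²(m-1)²`).  Its content was proved VERBATIM in the tree as
`Summit.HodgeConjecture.HodgeConjecture.BiquadraticSecantLift.biquadraticBaseChangePolarized`
(`Theorems/BiquadraticSecantLiftBiquadraticBaseChangePolarized.lean`, p608780), in a module that does not import the
route file.  The gate closes an item only by a theorem whose TYPE is literally the route declaration, so this module —
which imports both — restates nothing and merely re-types the landed theorem by the route declaration's name.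

Nothing here proves the Hodge conjecture, rung H2 `WeilSixfolds`, or the open crux X1pol of this route; HC_CM is untouched.

## References
[cite: Deligne1982HodgeCycles, §4 Thm. 4.8 (a)–(b)] [cite: vanGeemen1994HodgeAV, §5] [cite: Landherr1936HermitianForms]
-/

-- every declaration of this problem lives in `Summit.HodgeConjecture.HodgeConjecture.…` (summit = sub-problem)
set_option linter.dupNamespace false

namespace Summit.HodgeConjecture.HodgeConjecture.BiquadraticSecantLift

/-- **X2pol `BiquadraticBaseChangePolarized` (stmt-HodgeConjecture-26256) holds** — the route declaration, by name, from the
landed theorem `biquadraticBaseChangePolarized` (p608780; Deligne 1982 Thm. 4.8, Landherr 1936, van Geemen 1994 §5).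
The two types agree definitionally (the route file spells the same statement with fully qualified names).
HC / H2 / X1pol are NOT proved by this theorem. -/
theorem biquadraticBaseChangePolarized_proof :
    Summit.HodgeConjecture.HodgeConjecture.Theses.BiquadraticSecantLift.BiquadraticBaseChangePolarized :=
  biquadraticBaseChangePolarized

end Summit.HodgeConjecture.HodgeConjecture.BiquadraticSecantLift
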